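import Summits.FinalStateConjecture.FinalStateConjecture.Theorems.SwallowTheDatumKerrShieldedSettlesStubKerrVacuumAux14
import Summits.FinalStateConjecture.FinalStateConjecture.Theorems.SwallowTheDatumKerrShieldedSettlesStubKerrVacuumAux16
import Literature.Geometry.Lorentzian.ChartMetricCoord
import Literature.Geometry.Lorentzian.KerrSchildCoord
import HarnessLib

/-!
# The Kerr metric in ingoing Kerr–Schild coordinates is Ricci-flat: a Cartesian Kerr–Schild certificate

Registered sub-goal `stub_kerrVacuumSmoothCertificate` of line `tapered-temporal-collar` (crux
`stmt-FinalStateConjecture-10054`, stub `stub_kerrVacuum`): **`Ric(g_{M,a}) = 0` on the whole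
ingoing Kerr–Schild chart `Kerr.region a r₀`, for all real `M, a, r₀`** — the statement of the named
fact `Kerr.isRicciFlat M a r₀` (Kerr, PRL 11 (1963); Kerr–Schild 1965, §3; O'Neill 1995,
Thm. 2.6.1), proved here by an explicit coordinate certificate independent of
`Kerr.isRicciFlat_holds` (`KerrRicciFlat.lean`); the `a = 0` case is also
`Kerr.isRicciFlat_zero_spin` (`SchwarzschildKerrSchildRicciFlat.lean`).

Proof. At a point `x` of the chart the Ricci tensor of the `C^∞` metric is the coordinate Ricci form
of the components `G = Kerr.bilin M a` (`OpensChart.ricci_eq_ricAt`), the trace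
`Ric(∂_k, ∂_l) = ∑_i (R(∂_i, ∂_k)∂_l)^i` of
`R(X,Y) = D_XΓ_Y − D_YΓ_X + Γ_XΓ_Y − Γ_YΓ_X` (`MetricCoord.ricAt_eq_sum_coord`, `riemAt_apply`).
The Christoffel map is `Γ(∂_μ,∂_ν)^α = ½ ∑_β g^{αβ} K(∂_μ,∂_ν,∂_β)` with the closed forms `ginvT`,
`kT`, `gamT` of the algebra files (`chrAt_apply_eq_gamT`); the derivative term is paired with the
metric (`IsMetricOn.apply_fderiv_chrAt`, `fderiv_koszulCLM_apply₃`) and expressed through the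
second derivatives `d2gT` of the components (`…Aux12`); the term `∑_i (D_{∂_k}Γ(∂_i,∂_l))^i`
vanishes because `y ↦ ∑_i Γ(∂_i,∂_l)^i(y)` vanishes identically near `x` (unimodularity
`∑_i Γ^i_{il} = 0`, `gamT_trace`), and so does `∑_i Γ(∂_i, Γ(∂_k,∂_l))^i`. What is left is the
identity `½(Φ_{kl} + Φ_{lk} − Ξ_{kl}) − ∑_m Γ^m_{kl}Ψ_m − T_{kl} = 0` of `ricci_alg` (`…Aux11`).

## References

* R. P. Kerr, *Gravitational field of a spinning mass as an example of algebraically special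
  metrics*, Phys. Rev. Lett. 11 (1963) 237–238.
* R. P. Kerr, A. Schild, *A new class of vacuum solutions of the Einstein field equations* (1965),
  §3.
* B. O'Neill, *The geometry of Kerr black holes* (1995), Ch. 2, Thm. 2.6.1; *Semi-Riemannian
  geometry* (1983), Ch. 3, Lemma 3.38, Lemma 3.52.
-/

set_option linter.dupNamespace false
set_option maxSynthPendingDepth 3

noncomputable section

open Set Filter
open scoped Manifold ContDiff Topology
open Literature.Geometry.Lorentzian

namespace Summit.FinalStateConjecture.FinalStateConjecture.Theorems.SwallowTheDatum.KerrShieldedSettles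

namespace StubKerrVacuum

/-- The standard basis of `E4` as a `Module.Basis`. [folklore] -/
abbrev stdBasis : Module.Basis (Fin 4) ℝ E4 := (EuclideanSpace.basisFun (Fin 4) ℝ).toBasis

/-- The standard basis vectors are the coordinate vectors `∂_μ`. [folklore] -/
theorem stdBasis_apply (μ : Fin 4) : stdBasis μ = E4.basisVector μ := by
  simp [stdBasis, E4.basisVector]

variable [Kerr.Facts] (M a r₀ : ℝ)

/-- The components of the smooth Kerr metric are `Kerr.bilin M a` (by `rfl`). [cite: KerrSchild1965, §2] -/
theorem val_eq (y : Kerr.region a r₀) :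
    (Kerr.smoothMetric M a r₀).toPseudoRiemannianMetric.val y = Kerr.bilin M a y := rfl

/-- The Kerr–Schild components are a smooth symmetric nondegenerate metric on the chart domain.
[cite: KerrSchild1965, §2] -/
theorem isMetricOn : MetricCoord.IsMetricOn (Kerr.bilin M a) (Kerr.region a r₀ : Set E4) :=
  OpensChart.isMetricOn_repr (val_eq M a r₀)

/-- **The inverse metric coefficients in the standard basis are the table `ginvT`**
(`g^{ij} = η^{ij} − 2H ℓ^i ℓ^j`, `Kerr.sharp_dx_apply`). [cite: KerrSchild1965, §2] -/
theorem ginv_eq (y : Kerr.region a r₀) (i j : Fin 4) :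
    MetricCoord.ginv (Kerr.bilin M a) stdBasis y i j =
      ginvT a M ((y : E4) 1) ((y : E4) 2) (Kerr.radius a y) (Kerr.latitude a y) i j := by
  have hy : 0 < Kerr.radius a y := Kerr.radius_pos_of_mem_region y.2
  have hcoord : MetricCoord.coordCLM stdBasis j = (E4.dx j : E4 →L[ℝ] ℝ) := by
    ext v
    simp [MetricCoord.coordCLM, stdBasis]
  rw [MetricCoord.ginv, hcoord, ← OpensChart.sharp_eq_sharpAt (val_eq M a r₀) y]
  change (stdBasis).coord i _ = _
  rw [Kerr.coord_basisFun]
  exact (Kerr.sharp_dx_apply M a r₀ y j i).trans (inverseMetric_eq_ginvT M hy i j)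

/-- **The Christoffel symbols of the Kerr metric in closed form**: the `α`-component of the
Christoffel map `Γ(∂_μ, ∂_ν) = ½ ♯K(∂_μ,∂_ν,·)` of the components `Kerr.bilin M a` is the table
value `gamT α μ ν` (`gamT_eq`, `kzT_eq`). [cite: KerrSchild1965, §3] -/
theorem chrAt_apply_eq_gamT (y : Kerr.region a r₀) (μ ν α : Fin 4) :
    MetricCoord.chrAt (Kerr.bilin M a) y (E4.basisVector μ) (E4.basisVector ν) α =
      gamT a M ((y : E4) 1) ((y : E4) 2) (Kerr.radius a y) (Kerr.latitude a y) α μ ν := by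
  have hy : 0 < Kerr.radius a y := Kerr.radius_pos_of_mem_region y.2
  have hr := hy.ne'
  have hS := sig_ne_zero hy
  have hP := psq_ne_zero hy
  have hC := rel_sq hy
  rw [MetricCoord.chrAt_apply, PiLp.smul_apply, smul_eq_mul, ← Kerr.coord_basisFun α,
    MetricCoord.coord_sharpAt_eq_sum stdBasis, ← gamT_eq _ _ _ _ _ _ hr hS hP hC α μ ν]
  congr 1
  refine Finset.sum_congr rfl fun β _ ↦ ?_
  rw [ginv_eq M a r₀ y, stdBasis_apply, MetricCoord.koszulCLM_apply, fderiv_bilin_eq_dgT M hy,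
    fderiv_bilin_eq_dgT M hy, fderiv_bilin_eq_dgT M hy, ← kzT_eq _ _ _ _ _ _ hr hS hP hC μ ν β]
  rfl

/-- The Christoffel map on coordinate vectors as a vector: `Γ(∂_μ, ∂_ν) = ∑_m Γ^m_{μν} ∂_m`.
[cite: KerrSchild1965, §3] -/
theorem chrAt_basis_eq_sum (y : Kerr.region a r₀) (μ ν : Fin 4) :
    MetricCoord.chrAt (Kerr.bilin M a) y (E4.basisVector μ) (E4.basisVector ν) =
      ∑ m : Fin 4, gamT a M ((y : E4) 1) ((y : E4) 2) (Kerr.radius a y) (Kerr.latitude a y) m μ ν • E4.basisVector m := by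
  conv_lhs => rw [Kerr.eq_sum_basisVector
    (MetricCoord.chrAt (Kerr.bilin M a) y (E4.basisVector μ) (E4.basisVector ν))]
  refine Finset.sum_congr rfl fun m _ ↦ ?_
  rw [chrAt_apply_eq_gamT M a r₀ y]

/-- The iterated Christoffel map, componentwise: `Γ(∂_k, Γ(∂_i, ∂_l))^j = ∑_m Γ^m_{il} Γ^j_{km}`.
[cite: KerrSchild1965, §3] -/
theorem chrAt_chrAt_apply (y : Kerr.region a r₀) (k i l j : Fin 4) :
    MetricCoord.chrAt (Kerr.bilin M a) y (E4.basisVector k)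
        (MetricCoord.chrAt (Kerr.bilin M a) y (E4.basisVector i) (E4.basisVector l)) j =
      ∑ m : Fin 4, gamT a M ((y : E4) 1) ((y : E4) 2) (Kerr.radius a y) (Kerr.latitude a y) m i l * gamT a M ((y : E4) 1) ((y : E4) 2) (Kerr.radius a y) (Kerr.latitude a y) j k m := by
  rw [chrAt_basis_eq_sum M a r₀ y i l, map_sum, ← Kerr.coord_basisFun j, map_sum]
  refine Finset.sum_congr rfl fun m _ ↦ ?_
  rw [map_smul, map_smul, smul_eq_mul, Kerr.coord_basisFun, chrAt_apply_eq_gamT M a r₀ y]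

/-- **Unimodularity on the chart**: `∑_i Γ(∂_i, ∂_l)^i(y) = 0` at every point of the chart domain
(`∑_i Γ^i_{il} = 0`, `gamT_trace`). [cite: KerrSchild1965, §2] -/
theorem sum_chrAt_diag_eq_zero (y : Kerr.region a r₀) (l : Fin 4) :
    ∑ i : Fin 4, MetricCoord.chrAt (Kerr.bilin M a) y (E4.basisVector i) (E4.basisVector l) i = 0 := by
  have hy : 0 < Kerr.radius a y := Kerr.radius_pos_of_mem_region y.2
  simp only [chrAt_apply_eq_gamT M a r₀ y]
  exact gamT_trace a M ((y : E4) 1) ((y : E4) 2) (Kerr.radius a y) (Kerr.latitude a y) hy.ne' (sig_ne_zero hy) (psq_ne_zero hy) (rel_sq hy) l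

/-- The term `∑_i (D_{∂_k} Γ(∂_i, ∂_l))^i` of the Ricci trace vanishes: it is the derivative along
`∂_k` of the identically vanishing function `y ↦ ∑_i Γ(∂_i, ∂_l)^i(y)`. [cite: KerrSchild1965, §2] -/
theorem sum_fderiv_chrAt_diag_eq_zero (x : Kerr.region a r₀) (k l : Fin 4) :
    ∑ i : Fin 4, fderiv ℝ (MetricCoord.chrAt (Kerr.bilin M a)) x (E4.basisVector k)
      (E4.basisVector i) (E4.basisVector l) i = 0 := by
  have hGm := isMetricOn M a r₀
  have hxV : (x : E4) ∈ (Kerr.region a r₀ : Set E4) := x.2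
  have hD := hGm.differentiableAt_chrAt hxV
  have hdi : ∀ i : Fin 4, DifferentiableAt ℝ
      (fun y ↦ MetricCoord.chrAt (Kerr.bilin M a) y (E4.basisVector i) (E4.basisVector l)) x :=
    fun i ↦ MetricCoord.differentiableAt_clm_apply_const
      (MetricCoord.differentiableAt_clm_apply_const hD _) _
  -- the component functions and their derivatives
  have hcomp : ∀ i : Fin 4, fderiv ℝ (MetricCoord.chrAt (Kerr.bilin M a)) x (E4.basisVector k)
      (E4.basisVector i) (E4.basisVector l) i =
      fderiv ℝ (fun y ↦ MetricCoord.chrAt (Kerr.bilin M a) y (E4.basisVector i)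
        (E4.basisVector l) i) x (E4.basisVector k) := by
    intro i
    have h := ((E4.dx i).hasFDerivAt.comp (x : E4) (hdi i).hasFDerivAt).fderiv
    rw [← hGm.fderiv_chrAt_apply₂ hxV]
    exact (congrArg (fun L : E4 →L[ℝ] ℝ ↦ L (E4.basisVector k)) h).symm
  simp only [hcomp]
  have hdiff : ∀ i ∈ (Finset.univ : Finset (Fin 4)), DifferentiableAt ℝ
      (fun y ↦ MetricCoord.chrAt (Kerr.bilin M a) y (E4.basisVector i) (E4.basisVector l) i) x :=
    fun i _ ↦ ((E4.dx i).hasFDerivAt.comp (x : E4) (hdi i).hasFDerivAt).differentiableAt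
  have hs := fderiv_fun_sum hdiff
  have hsum : ∑ i : Fin 4, fderiv ℝ (fun y ↦ MetricCoord.chrAt (Kerr.bilin M a) y (E4.basisVector i)
      (E4.basisVector l) i) x (E4.basisVector k) =
      fderiv ℝ (fun y ↦ ∑ i : Fin 4, MetricCoord.chrAt (Kerr.bilin M a) y (E4.basisVector i)
        (E4.basisVector l) i) x (E4.basisVector k) := by
    rw [hs, sum_apply]
  rw [hsum]
  have hev : (fun y ↦ ∑ i : Fin 4, MetricCoord.chrAt (Kerr.bilin M a) y (E4.basisVector i)
      (E4.basisVector l) i) =ᶠ[𝓝 (x : E4)] fun _ ↦ (0 : ℝ) := by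
    filter_upwards [(Kerr.region a r₀).2.mem_nhds hxV] with y hy
    exact sum_chrAt_diag_eq_zero M a r₀ ⟨y, hy⟩ l
  rw [hev.fderiv_eq]
  simp

/-- **The derivative term of the Ricci trace**: `∑_i (D_{∂_i} Γ(∂_k,∂_l))^i`, through the metric
pairing `G(D_vΓ(X,Y), W) = ½ ∂_v K(X,Y,W) − ∂_vG(Γ(X,Y), W)` (`IsMetricOn.apply_fderiv_chrAt`) and
the closed forms of `g^{iβ}`, `∂g`, `∂²g`, `Γ`. [cite: ONeill1983, Ch. 3, Lemma 3.38] -/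
theorem sum_fderiv_chrAt_eq (x : Kerr.region a r₀) (k l : Fin 4) :
    ∑ i : Fin 4, fderiv ℝ (MetricCoord.chrAt (Kerr.bilin M a)) x (E4.basisVector i)
      (E4.basisVector k) (E4.basisVector l) i =
      ∑ i : Fin 4, ∑ β : Fin 4, ginvT a M ((x : E4) 1) ((x : E4) 2) (Kerr.radius a x) (Kerr.latitude a x) i β *
        (2⁻¹ * (d2gT a M ((x : E4) 1) ((x : E4) 2) (Kerr.radius a x) (Kerr.latitude a x) i k l β + d2gT a M ((x : E4) 1) ((x : E4) 2) (Kerr.radius a x) (Kerr.latitude a x) i l β k - d2gT a M ((x : E4) 1) ((x : E4) 2) (Kerr.radius a x) (Kerr.latitude a x) i β k l)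
          - ∑ m : Fin 4, gamT a M ((x : E4) 1) ((x : E4) 2) (Kerr.radius a x) (Kerr.latitude a x) m k l * dgT a M ((x : E4) 1) ((x : E4) 2) (Kerr.radius a x) (Kerr.latitude a x) i m β) := by
  have hGm := isMetricOn M a r₀
  have hxV : (x : E4) ∈ (Kerr.region a r₀ : Set E4) := x.2
  have hx : 0 < Kerr.radius a x := Kerr.radius_pos_of_mem_region x.2
  have hinv := hGm.isInvertible _ hxV
  refine Finset.sum_congr rfl fun i _ ↦ ?_
  rw [← Kerr.coord_basisFun i, MetricCoord.coord_eq_sum_ginv stdBasis hinv]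
  refine Finset.sum_congr rfl fun β _ ↦ ?_
  rw [ginv_eq M a r₀ x, stdBasis_apply, hGm.apply_fderiv_chrAt hxV,
    hGm.fderiv_koszulCLM_apply₃ hxV, ← hGm.fderiv_fderiv_apply₃ hxV, ← hGm.fderiv_fderiv_apply₃ hxV,
    ← hGm.fderiv_fderiv_apply₃ hxV, fderiv_fderiv_bilin_eq_d2gT M hx, fderiv_fderiv_bilin_eq_d2gT M hx,
    fderiv_fderiv_bilin_eq_d2gT M hx, chrAt_basis_eq_sum M a r₀ x k l, map_sum]
  congr 1
  simp only [FunLike.coe_sum, Finset.sum_apply, map_smul, FunLike.coe_smul, Pi.smul_apply, smul_eq_mul,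
    fderiv_bilin_eq_dgT M hx]

/-- **The quadratic term of the Ricci trace**: `∑_i Γ(∂_k, Γ(∂_i, ∂_l))^i = T_{kl}` (`t4T_eq`).
[cite: KerrSchild1965, §3] -/
theorem sum_chrAt_chrAt_eq (x : Kerr.region a r₀) (k l : Fin 4) :
    ∑ i : Fin 4, MetricCoord.chrAt (Kerr.bilin M a) x (E4.basisVector k)
      (MetricCoord.chrAt (Kerr.bilin M a) x (E4.basisVector i) (E4.basisVector l)) i =
      t4T a M ((x : E4) 1) ((x : E4) 2) (Kerr.radius a x) (Kerr.latitude a x) k l := by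
  have hx : 0 < Kerr.radius a x := Kerr.radius_pos_of_mem_region x.2
  simp only [chrAt_chrAt_apply M a r₀ x]
  exact t4T_eq a M ((x : E4) 1) ((x : E4) 2) (Kerr.radius a x) (Kerr.latitude a x) hx.ne' (sig_ne_zero hx) (psq_ne_zero hx) (rel_sq hx) k l

/-- The other quadratic term vanishes: `∑_i Γ(∂_i, Γ(∂_k, ∂_l))^i = ∑_m Γ^m_{kl} ∑_i Γ^i_{im} = 0`.
[cite: KerrSchild1965, §2] -/
theorem sum_chrAt_chrAt_eq_zero (x : Kerr.region a r₀) (k l : Fin 4) :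
    ∑ i : Fin 4, MetricCoord.chrAt (Kerr.bilin M a) x (E4.basisVector i)
      (MetricCoord.chrAt (Kerr.bilin M a) x (E4.basisVector k) (E4.basisVector l)) i = 0 := by
  have hx : 0 < Kerr.radius a x := Kerr.radius_pos_of_mem_region x.2
  have htr := gamT_trace a M ((x : E4) 1) ((x : E4) 2) (Kerr.radius a x) (Kerr.latitude a x) hx.ne' (sig_ne_zero hx) (psq_ne_zero hx) (rel_sq hx)
  simp only [chrAt_chrAt_apply M a r₀ x]
  rw [Finset.sum_comm]
  refine Finset.sum_eq_zero fun m _ ↦ ?_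
  rw [← Finset.mul_sum, htr m, mul_zero]

/-- **The frame components of the Ricci tensor of the Kerr metric vanish**: `Ric_x(∂_k, ∂_l) = 0`
for all `k, l` at every point of `Kerr.region a r₀`. [cite: KerrSchild1965, §3] -/
theorem ricci_basisVector [(Kerr.smoothMetric M a r₀).HasLeviCivita] (x : Kerr.region a r₀)
    (k l : Fin 4) :
    (Kerr.smoothMetric M a r₀).ricci x (E4.basisVector k) (E4.basisVector l) = 0 := by
  have hx : 0 < Kerr.radius a x := Kerr.radius_pos_of_mem_region x.2
  have hr := hx.ne'
  have hS := sig_ne_zero hx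
  have hP := psq_ne_zero hx
  have hC := rel_sq hx
  have hsymm : ∀ i β : Fin 4, d2gT a M ((x : E4) 1) ((x : E4) 2) (Kerr.radius a x) (Kerr.latitude a x) i l β k = d2gT a M ((x : E4) 1) ((x : E4) 2) (Kerr.radius a x) (Kerr.latitude a x) i l k β :=
    fun i β ↦ d2gT_symm a M ((x : E4) 1) ((x : E4) 2) (Kerr.radius a x) (Kerr.latitude a x) i l β k
  rw [OpensChart.ricci_eq_ricAt (val_eq M a r₀) x, MetricCoord.ricAt_eq_sum_coord stdBasis]
  simp only [stdBasis_apply, MetricCoord.riemAt_apply, map_sub, map_add, Kerr.coord_basisFun,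
    Finset.sum_sub_distrib, Finset.sum_add_distrib]
  rw [sum_fderiv_chrAt_eq M a r₀ x k l, sum_fderiv_chrAt_diag_eq_zero M a r₀ x k l,
    sum_chrAt_chrAt_eq_zero M a r₀ x k l, sum_chrAt_chrAt_eq M a r₀ x k l]
  have key := ricci_alg a M ((x : E4) 1) ((x : E4) 2) (Kerr.radius a x) (Kerr.latitude a x) hr hS hP hC k l
  rw [← phiT_eq a M ((x : E4) 1) ((x : E4) 2) (Kerr.radius a x) (Kerr.latitude a x) hr hS hP hC k l, ← phiT_eq a M ((x : E4) 1) ((x : E4) 2) (Kerr.radius a x) (Kerr.latitude a x) hr hS hP hC l k,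
    ← xiT_eq a M ((x : E4) 1) ((x : E4) 2) (Kerr.radius a x) (Kerr.latitude a x) hr hS hP hC k l] at key
  simp only [← psiT_eq a M ((x : E4) 1) ((x : E4) 2) (Kerr.radius a x) (Kerr.latitude a x) hr hS hP hC] at key
  simp only [hsymm, sub_zero, add_zero]
  simp only [Fin.sum_univ_four, Fin.isValue] at key ⊢
  linear_combination key

/-- **The Ricci tensor of the Kerr metric vanishes** at every point of `Kerr.region a r₀`
(a bilinear form vanishing on the coordinate basis). Kerr, PRL 11 (1963); Kerr–Schild 1965, §3;
O'Neill 1995, Thm. 2.6.1. [cite: KerrSchild1965, §3] -/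
theorem ricci_smoothMetric_eq_zero [(Kerr.smoothMetric M a r₀).HasLeviCivita] (x : Kerr.region a r₀) :
    (Kerr.smoothMetric M a r₀).ricci x = 0 := by
  set β : Module.Basis (Fin 4) ℝ (TangentSpace 𝓘(ℝ, E4) x) :=
    (EuclideanSpace.basisFun (Fin 4) ℝ).toBasis with hβdef
  have hβ : ∀ i, β i = E4.basisVector i := fun i ↦
    (congrFun (EuclideanSpace.basisFun (Fin 4) ℝ).coe_toBasis i).trans
      (EuclideanSpace.basisFun_apply (Fin 4) ℝ i)
  refine LinearMap.BilinForm.ext_basis β fun k l ↦ ?_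
  rw [hβ, hβ, ricci_basisVector M a r₀ x k l]
  rfl

end StubKerrVacuum

/-- **`stub_kerrVacuumSmoothCertificate` — an independent Cartesian Kerr–Schild certificate that the
Kerr metric is Ricci-flat on the whole ingoing Kerr–Schild chart**, for all real `M, a, r₀`, stated for
the definitional packaging `Kerr.smoothMetric` (`Kerr.metric = Kerr.smoothMetric` by
`Kerr.metric_eq`, which turns this into the statement of the stub `stub_kerrVacuum` / of
`Kerr.isRicciFlat`). Proved by the closed-form coordinate computation of the
support files `…StubKerrVacuumAux1–16`, independently of `Kerr.isRicciFlat_holds`. -/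
theorem stub_kerrVacuumSmoothCertificate : ∀ [Kerr.Facts] (M a r₀ : ℝ)
    [(Kerr.smoothMetric M a r₀).HasLeviCivita] (x : Kerr.region a r₀),
    (Kerr.smoothMetric M a r₀).ricci x = 0 :=
  fun M a r₀ _ x ↦ StubKerrVacuum.ricci_smoothMetric_eq_zero M a r₀ x

end Summit.FinalStateConjecture.FinalStateConjecture.Theorems.SwallowTheDatum.KerrShieldedSettles

end
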